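import Literature.Computability.MetaComplexity.EFOrder
import HarnessLib

/-!
# Modular addition in extended Frege, uniform width: the template and its view

Layer D (uniform variant) of the `EF`-proof construction kit. The template `ModAddU.modAddT L`
computes, on three `L`-bit words `a`, `b`, `n`, the adder `S = a + b` (sum bits only), the
subtractor/comparator `D = S - n` (`EFSub.lean`) with `ge = [S ≥ n]`, and the output word
`Rᵢ = ge ? (S - n)ᵢ : Sᵢ` — all of the SAME width `L`. There is no internal zero-extension and
no carry-out handling: the caller keeps every word zero-extended (operands `< n < 2^m` on
`L ≥ m + 2` bits, the top bits being the zero variable), so that no adder overflows and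
`R = (a + b) mod n` for `a, b < n`. The point of the uniform width is that every law of modular
addition becomes *position-uniform* — one carry induction with a machine-found invariant
(`EFCluster.lean`) read off at every position, with no special top position — which is what
makes associativity tractable (`EFModAddUAssoc.lean`).

This file: the template, its well-formedness (`ModAddU.wf_modAddT`), the view of an occurrence
(`ModAddU.View`: base and operand words; the inner adder `View.S`, subtractor `View.D`,
comparison bit `View.ge`, outputs `View.R`), availability (`View.Avail`) and its derivation
from an instance (`ModAddU.avail_viewOf`). The sibling file `EFModAdd.lean` (`ModAdd.addModT`,
`W`-bit result with a domain wire) is an independent variant of the same circuit; the laws in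
`EFModAddULaws.lean` / `EFModAddUAssoc.lean` are about the present uniform one.

## Sources

* H. Vollmer, *Introduction to Circuit Complexity* (Springer 1999), §1.1–1.2 (addition,
  subtraction by complement, multiplexers; composition of circuits).
* J. Krajíček, *Bounded Arithmetic, Propositional Logic, and Complexity Theory* (CUP 1995),
  §9.2 (elementary laws of binary arithmetic have polynomial-size `EF` proofs; constructed
  here directly).
-/

namespace Literature.Computability.MetaComplexity

open _root_.Computability Complexity Complexity.PropForm Netlist

namespace ModAddU

/-! ### The template `(a + b) mod n` on `L`-bit words -/

/-- Wiring of the subtractor `S - n`: minuend = the sum bits of the adder `S = a + b` (wires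
`2i+1`), subtrahend = the input word `n` (inputs `2L … 3L-1`). [folklore] -/
def wD (L : ℕ) (i : ℕ) : ℕ ⊕ ℕ := if i < L then Sum.inr (2 * i + 1) else Sum.inl (2 * L + (i - L))

/-- The output multiplexer `Rᵢ = ge ? dᵢ : sᵢ`. [folklore] -/
def muxGate (L i : ℕ) : TGate := ⟨Kind.mux, [Sum.inr (5 * L + 1), Sum.inr (3 * L + 2 + 2 * i), Sum.inr (2 * i + 1)]⟩

/-- **The modular-addition template** on `L`-bit words `a` (inputs `0…L-1`), `b` (`L…2L-1`),
`n` (`2L…3L-1`): the adder `S = a + b` (wires `0…2L`, sum bits `sᵢ` at `2i+1`; its carry-out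
is not used), the subtractor `D = S - n` on the sum bits (wires `2L+1 … 5L+1`, difference bits
`dᵢ` at `3L+2+2i`, comparison bit `ge = [S ≥ n]` at `5L+1`), and the output word
`Rᵢ = ge ? dᵢ : sᵢ` (wires `5L+2 … 6L+1`). Intended use: `a, b < n < 2^{L-1}`, so that `S`
does not overflow and `R = (a + b) mod n`. [cite: Vollmer1999, §1.1] -/
def modAddT (L : ℕ) : Template :=
  embed (Adder.addT false L) Sum.inl 0 ++ embed (Sub.subT L) (wD L) (2 * L + 1) ++ (List.range L).map (muxGate L)

/-- Length of the modular-addition template. [folklore] -/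
@[simp] theorem length_modAddT (L : ℕ) : (modAddT L).length = 6 * L + 2 := by
  simp [modAddT]; ring

/-- The adder part by index. [folklore] -/
theorem modAddT_adder (L : ℕ) {k : ℕ} (hk : k < (Adder.addT false L).length) :
    ∃ hk' : 0 + k < (modAddT L).length, (modAddT L)[0 + k] =
      ⟨((Adder.addT false L)[k]).kind, ((Adder.addT false L)[k]).args.map (remap Sum.inl 0)⟩ := by
  have hk' : 0 + k < (modAddT L).length := by simp at hk ⊢; omega
  refine ⟨hk', Option.some_inj.1 ?_⟩
  rw [← List.getElem?_eq_getElem hk', modAddT, List.append_assoc, List.getElem?_append_left (by simpa using hk)]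
  simp [embed, List.getElem?_eq_getElem hk]

/-- The subtractor part by index. [folklore] -/
theorem modAddT_sub (L : ℕ) {k : ℕ} (hk : k < (Sub.subT L).length) :
    ∃ hk' : 2 * L + 1 + k < (modAddT L).length, (modAddT L)[2 * L + 1 + k] =
      ⟨((Sub.subT L)[k]).kind, ((Sub.subT L)[k]).args.map (remap (wD L) (2 * L + 1))⟩ := by
  have hk' : 2 * L + 1 + k < (modAddT L).length := by simp at hk ⊢; omega
  refine ⟨hk', Option.some_inj.1 ?_⟩
  rw [← List.getElem?_eq_getElem hk', modAddT, List.append_assoc, List.getElem?_append_right (by simp),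
    List.getElem?_append_left (by simp at hk ⊢; omega)]
  simp [embed, List.getElem?_eq_getElem hk]

/-- The multiplexer part by index. [folklore] -/
theorem modAddT_mux (L : ℕ) {i : ℕ} (hi : i < L) (h : 5 * L + 2 + i < (modAddT L).length) :
    (modAddT L)[5 * L + 2 + i] = muxGate L i := by
  apply Option.some_inj.1
  rw [← List.getElem?_eq_getElem h, modAddT, List.append_assoc, List.getElem?_append_right (by simp; omega),
    List.getElem?_append_right (by simp; omega),
    show 5 * L + 2 + i - (embed (Adder.addT false L) Sum.inl 0).length - (embed (Sub.subT L) (wD L) (2 * L + 1)).length = i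
      by simp; omega]
  simp [hi]

/-- Every index of the template falls into one of the three parts. [folklore] -/
theorem index_cases (L k : ℕ) (hk : k < 6 * L + 2) :
    (k < 2 * L + 1) ∨ (∃ k', k' < 3 * L + 1 ∧ k = 2 * L + 1 + k') ∨ ∃ i, i < L ∧ k = 5 * L + 2 + i := by
  by_cases h₁ : k < 2 * L + 1
  · exact Or.inl h₁
  by_cases h₃ : k < 5 * L + 2
  · exact Or.inr (Or.inl ⟨k - (2 * L + 1), by omega, by omega⟩)
  · exact Or.inr (Or.inr ⟨k - (5 * L + 2), by omega, by omega⟩)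

/-- **The modular-addition template is well formed** (`3L` inputs). [cite: Vollmer1999, §1.2] -/
theorem wf_modAddT (L : ℕ) : (modAddT L).WF (3 * L) := by
  intro k hk
  rcases index_cases L k (by simpa using hk) with h | ⟨k', hk', rfl⟩ | ⟨i, hi, rfl⟩
  · obtain ⟨_, heq⟩ := modAddT_adder L (k := k) (by simpa using h)
    simp only [Nat.zero_add] at heq
    rw [heq]
    have := wf_embed_gate (Adder.wf_addT false L) (w := Sum.inl) (off := 0) (nIn := 3 * L)
      (fun i hi => ⟨fun i' hi' => (by cases hi'; omega), fun j hj => (by cases hj)⟩) (by simpa using h)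
    simpa using this
  · obtain ⟨_, heq⟩ := modAddT_sub L (k := k') (by simpa using hk')
    rw [heq]
    exact wf_embed_gate (Sub.wf_subT L) (fun i hi => by
      unfold wD
      split_ifs with h1
      · exact ⟨fun i' hi' => (by cases hi'), fun j hj => (by cases hj; omega)⟩
      · exact ⟨fun i' hi' => (by cases hi'; omega), fun j hj => (by cases hj)⟩) (by simpa using hk')
  · rw [modAddT_mux L hi]
    refine ⟨rfl, fun a ha => ?_⟩
    simp only [muxGate, List.mem_cons, List.not_mem_nil, or_false] at ha
    rcases ha with rfl | rfl | rfl <;> exact ⟨fun i' hi' => (by cases hi'), fun j hj => (by cases hj; omega)⟩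

/-! ### The view -/

/-- A view of a modular adder: the base of its gates and its three operand words. [folklore] -/
structure View where
  /-- the first gate variable -/
  base : ℕ
  /-- the first summand -/
  a : ℕ → ℕ
  /-- the second summand -/
  b : ℕ → ℕ
  /-- the modulus -/
  n : ℕ → ℕ

namespace View

/-- The adder `S = a + b`. [folklore] -/
def S (M : View) : Adder.View := ⟨M.base, M.a, M.b⟩
/-- The subtractor `D = S - n` on the sum bits. [folklore] -/
def D (M : View) (L : ℕ) : Sub.View := ⟨M.base + (2 * L + 1), M.S.s, M.n⟩
/-- The comparison bit `ge = [S ≥ n]` (final carry of `D`). [folklore] -/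
def ge (M : View) (L : ℕ) : ℕ := (M.D L).ge L L
/-- The comparison carries of `D`. [folklore] -/
def Dc (M : View) (L i : ℕ) : ℕ := (M.D L).ge L i
/-- The difference bits `dᵢ = (S - n)ᵢ`. [folklore] -/
def d (M : View) (L i : ℕ) : ℕ := (M.D L).d L i
/-- The output bits `Rᵢ`. [folklore] -/
def R (M : View) (L i : ℕ) : ℕ := M.base + (5 * L + 2) + i
/-- The definition line of the output multiplexer `i`. [folklore] -/
def muxDef (M : View) (L i : ℕ) : PropForm ℕ :=
  biimp (var (M.R L i)) (muxF (var (M.ge L)) (var (M.d L i)) (var (M.S.s i)))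

/-- `M.Avail K Γ L`: all definition lines of the modular adder are available. [folklore] -/
def Avail (M : View) (K : PropForm ℕ) (Γ : Set (PropForm ℕ)) (L : ℕ) : Prop :=
  M.S.Avail K Γ false L ∧ (M.D L).Avail K Γ L ∧ ∀ i < L, ctx K (M.muxDef L i) ∈ Γ

/-- Availability is monotone. [folklore] -/
theorem Avail.mono {M : View} {K : PropForm ℕ} {Γ Γ' : Set (PropForm ℕ)} {L : ℕ} (h : M.Avail K Γ L)
    (hΓ : Γ ⊆ Γ') : M.Avail K Γ' L :=
  ⟨h.1.mono hΓ, h.2.1.mono hΓ, fun i hi => hΓ (h.2.2 i hi)⟩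

end View

/-- The view of an instance of the modular adder. [folklore] -/
def viewOf (P : Inst) (L : ℕ) : View :=
  ⟨P.base, fun i => P.inputs.getD i 0, fun i => P.inputs.getD (L + i) 0, fun i => P.inputs.getD (2 * L + i) 0⟩

/-- **An instance of the modular adder whose definitions are available provides an available
view.** [folklore] -/
theorem avail_viewOf {P : Inst} {K : PropForm ℕ} {Γ : Set (PropForm ℕ)} {L : ℕ}
    (hP : P.DefsAvail (modAddT L) K Γ) : (viewOf P L).Avail K Γ L := by
  refine ⟨?_, ?_, fun i hi => ?_⟩
  · have hA := Adder.avail_viewEmb (c₀ := false) (W := L) (off := 0) (w := Sum.inl) hP (fun k hk => modAddT_adder L hk)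
    exact hA.congr (by simp [Adder.viewEmb, viewOf, View.S]) (fun i _ => rfl) (fun i _ => rfl)
  · have hS := Sub.avail_viewEmb (w := L) (off := 2 * L + 1) (wv := wD L) hP (fun k hk => modAddT_sub L hk)
    refine hS.congr (by simp [Sub.viewEmb, viewOf, View.D]) (fun i hi => ?_) (fun i hi => ?_)
    · simp only [Sub.viewEmb, viewOf, View.D, View.S, wD, Adder.View.s, Adder.View.wire, Inst.ref, Inst.wire, if_pos hi]
    · simp only [Sub.viewEmb, viewOf, View.D, wD, Inst.ref, if_neg (show ¬ (L + i < L) by omega),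
        show 2 * L + (L + i - L) = 2 * L + i by omega]
  · have h := hP (5 * L + 2 + i) (by simp; omega)
    rw [modAddT_mux L hi] at h
    simpa [viewOf, View.muxDef, View.R, View.ge, View.d, View.D, View.S, Sub.View.ge, Sub.View.d,
      Sub.View.adder, Adder.View.c, Adder.View.s, Adder.View.wire, muxGate, Inst.body, Inst.wire,
      Kind.body, arg, Inst.ref, Nat.add_assoc, show 2 * L + (1 + (L + 2 * L)) = 5 * L + 1 by ring,
      show 2 * L + (1 + (L + (2 * i + 1))) = 3 * L + (2 + 2 * i) by ring] using h

end ModAddU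

end Literature.Computability.MetaComplexity
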